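import Mathlib
import HarnessLib
import Literature.NumberTheory.LFunctions.ZetaScrew
import Summits.RiemannHypothesis.RiemannHypothesis.Theorems.IntegerScrewIncrementSharp

/-!
# Route `IntegerScrew` — an RH-FREE CEILING for the balanced window bottom:
# every coercivity constant of `S_M` on the balanced vectors of a window `(N, M]` is `≤ Ψ(h_M) ≤ (½ log M + 6)/M`

PIVOT-LAW §16.3/16.6 (pivot-theory-1 gen21) MEASURED the bottom of the balanced spectrum of the screw
matrix `S_M = [G(log m, log m')]` (`G(t,u) = Ψ(t) + Ψ(u) − Ψ(t−u)`, `Ψ = zetaScrew`) on fixed-ratio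
windows `(M/r, M]`: `M·λ_min^{bal}(r, M) ≈ α(r) log M + β(r)` with `α(2…8) = 0.24 … 0.15` [FITTED],
super-logarithmic in places (16.6 (cont.)).  THEOREM-grade so far: `λ_min^{bal} ≥ 0` for ratio `≤ 7`
(§16.2, p463190) and the exact dictionary with the Weil rungs (§16.7, p491937/p492585).  This file adds
the RH-free CEILING: the increment vector `e_M − e_{M−1}` is balanced, has squared norm `2` and screw
form `2Ψ(h_M)`, `h_M = log M − log(M−1)`, so

* `screwWindow_coercivity_le_zetaScrew` — if `c·∑_{(N,M]} x_m² ≤ ∑ G(log m, log m') x_m x_{m'}` for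
  every balanced real `x` on `(N, M]` (`N + 2 ≤ M`), then `c ≤ Ψ(log M − log(M−1))`;
* `screwWindow_coercivity_mul_le_log` — hence `2·M·c ≤ log M − c₀ + (log M + 19)/(M − 1)`,
  `c₀ = log 2π + γ₀ − 1 = 1.415…` (the SHARP increment energy `IntegerScrewIncrementSharp.abs_incrementEnergy_sub_le`);
* `screwWindow_coercivity_mul_le_half_log` — the clean form `M·c ≤ (log M)/2 + 6` (`M ≥ 3`).

So every window law of §16.6 is at most logarithmic: `0 ≤ M·λ_min^{bal}(r, M) ≤ ½ log M + 6` for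
`r ≤ 7`, RH-free (the lower bound is §16.2; the fitted slopes `α(r) ≤ 0.25` sit below the ceiling `½`,
and the «super-logarithmic» stretches of 16.6 (cont.) must saturate under it).  LABEL: RH-FREE
(prime-free wall analysis of `Ψ` near `0`); nothing here bears on the truth of RH.

References: M. Suzuki, J. Lond. Math. Soc. (2) 108 (2023) = arXiv:2206.03682, (1.1), (1.4) and the
proof of Thm 4.1 [Suzuki2023].
-/

noncomputable section

-- D-0017: `Summit.<S>.<S>.…` is the designed namespace of a single-problem summit.
set_option linter.dupNamespace false

namespace Summit.RiemannHypothesis.RiemannHypothesis.Theorems.IntegerScrew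

open Literature.NumberTheory.LFunctions Finset

/-- **Increment test vector.** If `c` is a coercivity constant of the screw form on the balanced real
vectors supported on the window `(N, M]`, `N + 2 ≤ M` — `c·∑ x_m² ≤ ∑∑ G(log m, log m') x_m x_{m'}`
whenever `∑ x_m = 0` — then `c ≤ Ψ(log M − log(M−1))`: test with `x = e_M − e_{M−1}`, whose form is
`G(a,a) + G(b,b) − 2G(a,b) = 2Ψ(a − b)` (`a = log M`, `b = log(M−1)`, `Ψ(0) = 0`). [folklore] -/
theorem screwWindow_coercivity_le_zetaScrew (N M : ℕ) (hM : N + 2 ≤ M) (c : ℝ)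
    (hc : ∀ x : ℕ → ℝ, ∑ m ∈ Ioc N M, x m = 0 →
      c * ∑ m ∈ Ioc N M, x m ^ 2 ≤
        ∑ m ∈ Ioc N M, ∑ m' ∈ Ioc N M,
          zetaScrewKernel (Real.log m) (Real.log m') * (x m * x m')) :
    c ≤ zetaScrew (Real.log M - Real.log ((M : ℝ) - 1)) := by
  classical
  -- the increment vector `e_M − e_{M−1}`
  set x : ℕ → ℝ := fun m => if m = M then 1 else if m = M - 1 then -1 else 0 with hx
  have hMM : M - 1 ≠ M := by omega
  have hM' : M ≠ M - 1 := fun h => hMM h.symm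
  have hmemM : M ∈ Ioc N M := Finset.mem_Ioc.2 ⟨by omega, le_rfl⟩
  have hmemM1 : M - 1 ∈ Ioc N M := Finset.mem_Ioc.2 ⟨by omega, by omega⟩
  have hxM : x M = 1 := by simp [hx]
  have hxM1 : x (M - 1) = -1 := by simp [hx, hMM]
  have hx0 : ∀ m ∈ Ioc N M, m ≠ M ∧ m ≠ M - 1 → x m = 0 := fun m _ hm => by
    simp [hx, hm.1, hm.2]
  -- sums of anything supported on `{M, M−1}`
  have hsum : ∀ f : ℕ → ℝ, ∑ m ∈ Ioc N M, x m * f m = f M - f (M - 1) := by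
    intro f
    rw [Finset.sum_eq_add_of_mem M (M - 1) hmemM hmemM1 hM' (fun m hm hne => by
      rw [hx0 m hm hne, zero_mul]), hxM, hxM1]
    ring
  have hsum1 : ∑ m ∈ Ioc N M, x m = 0 := by
    have h := hsum fun _ => 1
    simp only [mul_one, sub_self] at h
    exact h
  have hsum2 : ∑ m ∈ Ioc N M, x m ^ 2 = 2 := by
    have h := hsum x
    rw [hxM, hxM1] at h
    have e : ∀ m, x m ^ 2 = x m * x m := fun m => sq (x m)
    simp only [e]
    linarith
  -- the form of the increment vector is `2Ψ(log M − log(M−1))`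
  have hcast : ((M - 1 : ℕ) : ℝ) = (M : ℝ) - 1 := by
    rw [Nat.cast_sub (by omega)]; simp
  have hform : ∑ m ∈ Ioc N M, ∑ m' ∈ Ioc N M,
      zetaScrewKernel (Real.log m) (Real.log m') * (x m * x m') =
        2 * zetaScrew (Real.log M - Real.log ((M : ℝ) - 1)) := by
    have e1 : ∀ m : ℕ, ∑ m' ∈ Ioc N M, zetaScrewKernel (Real.log m) (Real.log m') * (x m * x m') =
        x m * (zetaScrewKernel (Real.log m) (Real.log M) -
          zetaScrewKernel (Real.log m) (Real.log ((M : ℝ) - 1))) := by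
      intro m
      have h := hsum fun m' => zetaScrewKernel (Real.log m) (Real.log m')
      rw [hcast] at h
      rw [← h, Finset.mul_sum]
      exact Finset.sum_congr rfl fun m' _ => by ring
    simp only [e1]
    rw [hsum, hcast]
    simp only [zetaScrewKernel_def, sub_self, zetaScrew_zero]
    rw [show Real.log ((M : ℝ) - 1) - Real.log M = -(Real.log M - Real.log ((M : ℝ) - 1)) by ring,
      zetaScrew_neg]
    ring
  have key := hc x hsum1
  rw [hsum2, hform] at key
  linarith

/-- **The ceiling, sharp form** (RH-FREE): a balanced-window coercivity constant `c` on `(N, M]`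
(`N + 2 ≤ M`, `M ≥ 3`) obeys `2·M·c ≤ log M − c₀ + (log M + 19)/(M − 1)`, `c₀ = log 2π + γ₀ − 1`
(`abs_incrementEnergy_sub_le`: `M·2Ψ(h_M) = log M − c₀ + O(log M/M)`). [folklore] -/
theorem screwWindow_coercivity_mul_le_log (N M : ℕ) (hM : N + 2 ≤ M) (hM3 : 3 ≤ M) (c : ℝ)
    (hc : ∀ x : ℕ → ℝ, ∑ m ∈ Ioc N M, x m = 0 →
      c * ∑ m ∈ Ioc N M, x m ^ 2 ≤
        ∑ m ∈ Ioc N M, ∑ m' ∈ Ioc N M,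
          zetaScrewKernel (Real.log m) (Real.log m') * (x m * x m')) :
    2 * (M : ℝ) * c ≤ Real.log M - (Real.log (2 * Real.pi) + Real.eulerMascheroniConstant - 1)
      + (Real.log M + 19) / ((M : ℝ) - 1) := by
  have h1 := screwWindow_coercivity_le_zetaScrew N M hM c hc
  have hM' : (3 : ℝ) ≤ (M : ℝ) := by exact_mod_cast hM3
  have hMpos : (0 : ℝ) < M := by linarith
  have hM1 : (0 : ℝ) < (M : ℝ) - 1 := by linarith
  have hlogdiv : Real.log ((M : ℝ) / ((M : ℝ) - 1)) = Real.log M - Real.log ((M : ℝ) - 1) :=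
    Real.log_div hMpos.ne' hM1.ne'
  have h2 := abs_incrementEnergy_sub_le M hM3
  rw [hlogdiv] at h2
  have h3 := (abs_le.1 h2).2
  nlinarith

/-- **The ceiling, clean form** (RH-FREE): `M·c ≤ (log M)/2 + 6` for every balanced-window coercivity
constant `c` on `(N, M]`, `N + 2 ≤ M`, `M ≥ 3` (`c₀ ≥ 0` and `(log M + 19)/(M − 1) ≤ 11`).  With §16.2:
`0 ≤ M·λ_min^{bal} ≤ ½ log M + 6` on every window of ratio `≤ 7` — the window laws of PIVOT-LAW §16.6
are at most logarithmic. [folklore] -/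
theorem screwWindow_coercivity_mul_le_half_log (N M : ℕ) (hM : N + 2 ≤ M) (hM3 : 3 ≤ M) (c : ℝ)
    (hc : ∀ x : ℕ → ℝ, ∑ m ∈ Ioc N M, x m = 0 →
      c * ∑ m ∈ Ioc N M, x m ^ 2 ≤
        ∑ m ∈ Ioc N M, ∑ m' ∈ Ioc N M,
          zetaScrewKernel (Real.log m) (Real.log m') * (x m * x m')) :
    (M : ℝ) * c ≤ Real.log M / 2 + 6 := by
  have h1 := screwWindow_coercivity_mul_le_log N M hM hM3 c hc
  have hM' : (3 : ℝ) ≤ (M : ℝ) := by exact_mod_cast hM3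
  have hM1 : (0 : ℝ) < (M : ℝ) - 1 := by linarith
  -- `c₀ = log 2π + γ₀ − 1 ≥ 0`: `2π ≥ e` and `γ₀ ≥ 0`
  have hc0 : 0 ≤ Real.log (2 * Real.pi) + Real.eulerMascheroniConstant - 1 := by
    have hγ : (0 : ℝ) ≤ Real.eulerMascheroniConstant :=
      le_of_lt (lt_trans (by norm_num) Real.one_half_lt_eulerMascheroniConstant)
    have h2pi : (1 : ℝ) ≤ Real.log (2 * Real.pi) := by
      rw [Real.le_log_iff_exp_le (by positivity)]
      have he := Real.exp_one_lt_d9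
      have hπ := Real.pi_gt_three
      linarith
    linarith
  -- `(log M + 19)/(M − 1) ≤ 11`: `log M ≤ M − 1` and `19/(M−1) ≤ 10`
  have hfrac : (Real.log M + 19) / ((M : ℝ) - 1) ≤ 11 := by
    rw [div_le_iff₀ hM1]
    have hlog : Real.log (M : ℝ) ≤ (M : ℝ) - 1 := Real.log_le_sub_one_of_pos (by linarith)
    nlinarith
  nlinarith
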